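import Summits.Parity.GeneralizedHardyLittlewood.Theorems.LeeYangFibresRelativeDimOneLowerDefs
import Summits.Parity.GeneralizedHardyLittlewood.Theorems.LeeYangFibresRelativeDimOneAmplificationAux
import Summits.Parity.GeneralizedHardyLittlewood.Theorems.LeeYangFibresRelativeDimOneEquivalence
import HarnessLib

/-!
# Route `LeeYangFibres`, crux `RelativeDimOne` (stmt-Parity-14113), line `translate-amplification`
# (decoupled form), stub `stub_lowerAmplification`: LOWER-HALF AMPLIFICATION

The registered stub `stub_lowerAmplification : CoarseLowerHLSlack → LowerRelativeDimOne`: coarse LOWER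
bounds `e^{-g(T)} β_∞𝔖 ≤ S(Φ,K) + ηN` for prime constellations, with ANY sub-exponential loss
`g(T) = o(T)` in the number `T` of forms and `o(N)` slack, already give the SHARP lower half
`(1 − ε) β_∞(Ψ,K) 𝔖(Ψ) ≤ S(Ψ,K) + εN` of the crux. This is the mirror image of the landed upper-half
amplification `GallagherBackwards.upperRelativeDimOne_of_coarseUpperHLSlack`
(`…UpperAmplification.lean`), i.e. the lower half of the transfer `stub_amplification`
(`…Amplification.lean`) run with lower inequalities only; it is simpler than the upper half because the
degenerate shifts are DROPPED by positivity (`S_H ≥ 0`, no degenerate count) and the low-mass regime is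
trivial by positivity. Its two unconditional inputs are the complete-sum identity `completeSum`
(`…RelativeDimOneDefs`) and Gallagher averaging for translate-constellations `singularMean : SingularMean`
(`…Equivalence`).

Schedule (given `t ≥ 1`, `L`, `ε > 0`; `e = min ε 1`, `S = S(Ψ,K,N) ≥ 0`, `M = β_∞(Ψ,K) 𝔖(Ψ) ≥ 0`):

* `g(T)/T → 0` gives `m` with `|g((m+1)t)| ≤ (m+1) log(1 + e/4)`, so at dimension `T = (m+1)t` the loss
  is `e^{-g(T)} ≥ A⁻¹`, `A = (1+e/4)^{m+1}`.
* LOW MASS `M < κN`, `κ = e/2`: `(1−ε) M ≤ M ≤ εN ≤ S + εN` (positivity of `S`).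
* HIGH MASS `M ≥ κN`: `S^{m+1} = ∑_{H ∈ [-2N,2N]^m} S(Ψ^{(H)}, K_H)` (`completeSum`)
  `≥ ∑_{H nondeg} S_H` (positivity) `≥ A⁻¹ ∑_{nondeg} M_H − (4N+1)^m η'N` (ATOM L at dimension `T`, size
  `‖Ψ^{(H)}‖_N ≤ (3m+1) max(L,1)`, convex `K_H ⊆ [-N,N]`) `≥ A⁻¹ ((1−ε₅) M^{m+1} − ε₅ N^{m+1}) −
  5^m N^m η' N` (`singularMean`) `≥ ((1 − e/2) M)^{m+1}` for `k = κ^{m+1}`, `ε₅ = e k/40`,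
  `η' = e k/(40 A 5^m)` and `(1−e/2)^{m+1} A ≤ 1 − 3e/40` (`lower_ratio`); `lower_high_mass_amplify` below
  does this bookkeeping (the lower half of `high_mass_amplify`), whence `S ≥ (1 − e/2) M ≥ (1−ε)M − εN` by
  monotonicity of `x ↦ x^{m+1}` on `ℝ≥0`.

References: Green–Tao, Ann. of Math. 171 (2010), Conj. 1.4 [GreenTao2010]; Gallagher, Mathematika 23
(1976) [Gallagher1976]; Tao–Vu, *Additive Combinatorics*, §2 (tensor power trick).
-/

noncomputable section

open scoped BigOperators Classical Topology
open Finset Filter MeasureTheory Literature.NumberTheory.Sieve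

namespace Summit.Parity.GeneralizedHardyLittlewood.Cruxes.RelativeDimOne.TranslateAmplification

/-! ### The tensor-power bookkeeping at high singular mass, lower half -/

/-- HIGH SINGULAR MASS, LOWER HALF (`k N^{m+1} ≤ M^{m+1}`, i.e. `κ N ≤ M` with `k = κ^{m+1}`). Over a
finite set `s` of shifts with good ones singled out by `p`: if `∑_s S_H = S^{m+1}` (complete sum),
`|∑_{good} M_H - M^{m+1}| ≤ ε₅ (M^{m+1} + N^{m+1})` (averaged main terms), `A⁻¹ M_H - η' N ≤ S_H` on
good shifts (coarse LOWER bounds only, `A ≥ 1`), `S_H ≥ 0` on ALL shifts (so the bad shifts are simply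
dropped — no degenerate count is needed on this side), `#s ≤ 5^m N^m`, and the parameters are
`ε₅ = e k/40`, `η' = e k/(40 A 5^m)` with `(1-e/2)^{m+1} A ≤ 1 - 3e/40`, then
`((1-e/2)M)^{m+1} ≤ S^{m+1}`, whence `(1 - e/2) M ≤ S` by monotonicity of `x ↦ x^{m+1}` on `ℝ≥0`
(the lower half of `high_mass_amplify`). -/
theorem lower_high_mass_amplify {ι : Type*} (s : Finset ι) (p : ι → Prop) [DecidablePred p]
    (SH MH : ι → ℝ) (m : ℕ) {N : ℕ} {S M A e k ε₅ η' : ℝ}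
    (hA : 1 ≤ A) (he0 : 0 ≤ e) (he1 : e ≤ 1) (hS : 0 ≤ S) (hM : 0 ≤ M)
    (hk0 : 0 ≤ k) (hk1 : k ≤ 1) (hkM : k * (N : ℝ) ^ (m + 1) ≤ M ^ (m + 1))
    (hε₅ : ε₅ = e * k / 40) (hη' : η' = e * k / (40 * A * 5 ^ m))
    (hX : ∑ H ∈ s, SH H = S ^ (m + 1))
    (hSig : |∑ H ∈ s.filter p, MH H - M ^ (m + 1)| ≤ ε₅ * (M ^ (m + 1) + (N : ℝ) ^ (m + 1)))
    (hGlo : ∀ H ∈ s, p H → A⁻¹ * MH H - η' * N ≤ SH H)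
    (h0 : ∀ H ∈ s, 0 ≤ SH H)
    (hcard : (s.card : ℝ) ≤ 5 ^ m * (N : ℝ) ^ m)
    (hAlo : (1 - e / 2) ^ (m + 1) * A ≤ 1 - 3 * e / 40) :
    (1 - e / 2) * M ≤ S := by
  have hA0 : 0 < A := by linarith
  have hP0 : 0 ≤ M ^ (m + 1) := pow_nonneg hM _
  have hη'0 : 0 ≤ η' := by rw [hη']; positivity
  -- the complete sum, split along `p`; the bad shifts are dropped by positivity
  have hlo := sum_filter_lower s p SH MH hGlo h0
  rw [hX] at hlo
  have hcardG : ((s.filter p).card : ℝ) ≤ 5 ^ m * (N : ℝ) ^ m :=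
    le_trans (by exact_mod_cast Finset.card_filter_le s p) hcard
  have hGslack : ((s.filter p).card : ℝ) * (η' * N) ≤ 5 ^ m * η' * (N : ℝ) ^ (m + 1) :=
    calc ((s.filter p).card : ℝ) * (η' * N) ≤ 5 ^ m * (N : ℝ) ^ m * (η' * N) :=
          mul_le_mul_of_nonneg_right hcardG (by positivity)
      _ = 5 ^ m * η' * (N : ℝ) ^ (m + 1) := by rw [pow_succ]; ring
  have hXlo : A⁻¹ * ∑ H ∈ s.filter p, MH H - 5 ^ m * η' * (N : ℝ) ^ (m + 1) ≤ S ^ (m + 1) := by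
    linarith
  -- the parameters against `k N^{m+1} ≤ M^{m+1}`
  have hθ : A * (5 ^ m * η' * (N : ℝ) ^ (m + 1)) ≤ e / 40 * M ^ (m + 1) := by
    have h1 : A * (5 ^ m * η' * (N : ℝ) ^ (m + 1)) = e / 40 * (k * (N : ℝ) ^ (m + 1)) := by
      rw [hη']
      field_simp
    rw [h1]
    exact mul_le_mul_of_nonneg_left hkM (by positivity)
  have hε₅Q : ε₅ * (N : ℝ) ^ (m + 1) ≤ e / 40 * M ^ (m + 1) := by
    have h1 : ε₅ * (N : ℝ) ^ (m + 1) = e / 40 * (k * (N : ℝ) ^ (m + 1)) := by rw [hε₅]; ring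
    rw [h1]
    exact mul_le_mul_of_nonneg_left hkM (by positivity)
  have hε₅P : ε₅ * M ^ (m + 1) ≤ e / 40 * M ^ (m + 1) := by
    refine mul_le_mul_of_nonneg_right ?_ hP0
    rw [hε₅]
    have h1 : e * k ≤ e := by nlinarith
    linarith
  have hSiglo := (abs_le.mp hSig).1
  have hSiglo' : (1 - e / 20) * M ^ (m + 1) ≤ ∑ H ∈ s.filter p, MH H := by linarith
  -- `S^{m+1} ≥ A⁻¹ (1 - 3e/40) M^{m+1} ≥ ((1 - e/2) M)^{m+1}`
  have hL : ((1 - e / 2) * M) ^ (m + 1) ≤ S ^ (m + 1) := by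
    have hθQ' : 5 ^ m * η' * (N : ℝ) ^ (m + 1) ≤ A⁻¹ * (e / 40 * M ^ (m + 1)) := by
      rw [← inv_mul_cancel_left₀ hA0.ne' (5 ^ m * η' * (N : ℝ) ^ (m + 1))]
      exact mul_le_mul_of_nonneg_left hθ (inv_nonneg.mpr hA0.le)
    have hASig' : A⁻¹ * ((1 - e / 20) * M ^ (m + 1)) ≤ A⁻¹ * ∑ H ∈ s.filter p, MH H :=
      mul_le_mul_of_nonneg_left hSiglo' (inv_nonneg.mpr hA0.le)
    have h1 : A⁻¹ * (1 - 3 * e / 40) * M ^ (m + 1) ≤ S ^ (m + 1) := by linarith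
    have h2 : (1 - e / 2) ^ (m + 1) ≤ A⁻¹ * (1 - 3 * e / 40) := by
      rw [inv_mul_eq_div, le_div_iff₀ hA0]
      exact hAlo
    have h3 : (1 - e / 2) ^ (m + 1) * M ^ (m + 1) ≤ A⁻¹ * (1 - 3 * e / 40) * M ^ (m + 1) :=
      mul_le_mul_of_nonneg_right h2 hP0
    rw [mul_pow]
    linarith
  -- `(m+1)`-th root
  have he2 : 0 ≤ 1 - e / 2 := by linarith
  exact (pow_le_pow_iff_left₀ (mul_nonneg he2 hM) hS (Nat.succ_ne_zero m)).mp hL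

/-! ### The stub: lower-half amplification -/

/-- **LOWER-HALF AMPLIFICATION** (registered stub `stub_lowerAmplification` of line
`translate-amplification`): coarse LOWER bounds `e^{-g(T)} β_∞𝔖 ≤ S + ηN` for prime constellations with
ANY sub-exponential loss `g(T) = o(T)` in the number of forms already give the SHARP lower half
`(1 − ε) β_∞𝔖 ≤ S + εN` of the crux, by the tensor-power trick over translate-constellations run with lower
inequalities only (see the module docstring for the schedule). -/
theorem stub_lowerAmplification : CoarseLowerHLSlack → LowerRelativeDimOne := by
  intro hCL
  obtain ⟨g, hg, hA⟩ := hCL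
  intro t L ht ε hε
  -- `e = min ε 1`
  obtain ⟨e, he⟩ : ∃ e : ℝ, e = min ε 1 := ⟨_, rfl⟩
  have he0 : 0 < e := by rw [he]; exact lt_min hε one_pos
  have he1 : e ≤ 1 := by rw [he]; exact min_le_right _ _
  have heε : e ≤ ε := by rw [he]; exact min_le_left _ _
  -- the number `m` of translates, from `g(T)/T → 0`
  have ht0 : (0 : ℝ) < t := by exact_mod_cast ht
  have ha0 : (0 : ℝ) < 1 + e / 4 := by positivity
  have hc : 0 < Real.log (1 + e / 4) / t := div_pos (Real.log_pos (by linarith)) ht0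
  obtain ⟨M₀, hM₀⟩ := exists_abs_le_mul_of_tendsto_div hg hc
  obtain ⟨m, hmM⟩ : ∃ m : ℕ, M₀ ≤ m := ⟨M₀, le_rfl⟩
  have hT1 : 1 ≤ (m + 1) * t := le_trans ht (Nat.le_mul_of_pos_left t (Nat.succ_pos m))
  obtain ⟨A, hAdef⟩ : ∃ A : ℝ, A = (1 + e / 4) ^ (m + 1) := ⟨_, rfl⟩
  have hA1 : 1 ≤ A := by rw [hAdef]; exact one_le_pow₀ (by linarith)
  have hgT : |g ((m + 1) * t)| ≤ ((m + 1 : ℕ) : ℝ) * Real.log (1 + e / 4) := by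
    have h1 : M₀ ≤ (m + 1) * t :=
      le_trans hmM (le_trans (Nat.le_succ m) (Nat.le_mul_of_pos_right _ ht))
    calc |g ((m + 1) * t)| ≤ Real.log (1 + e / 4) / t * (((m + 1) * t : ℕ) : ℝ) := hM₀ _ h1
      _ = ((m + 1 : ℕ) : ℝ) * Real.log (1 + e / 4) := by
          push_cast
          field_simp
  have hexpL := (exp_le_pow_of_abs_le ha0 hgT).2
  rw [← hAdef] at hexpL
  -- the mass threshold `κ = e/2` and `k = κ^{m+1}`
  obtain ⟨κ, hκ⟩ : ∃ κ : ℝ, κ = e / 2 := ⟨_, rfl⟩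
  have hκ0 : 0 < κ := by rw [hκ]; positivity
  have hκ1 : κ ≤ 1 := by rw [hκ]; linarith
  have hκε : κ ≤ ε := by rw [hκ]; linarith
  obtain ⟨k, hk⟩ : ∃ k : ℝ, k = κ ^ (m + 1) := ⟨_, rfl⟩
  have hk0 : 0 < k := by rw [hk]; exact pow_pos hκ0 _
  have hk1 : k ≤ 1 := by rw [hk]; exact pow_le_one₀ hκ0.le hκ1
  -- the small parameters
  obtain ⟨ε₅, hε₅⟩ : ∃ ε₅ : ℝ, ε₅ = e * k / 40 := ⟨_, rfl⟩
  have hε₅0 : 0 < ε₅ := by rw [hε₅]; positivity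
  obtain ⟨η', hη'⟩ : ∃ η' : ℝ, η' = e * k / (40 * A * 5 ^ m) := ⟨_, rfl⟩
  have hη'0 : 0 < η' := by rw [hη']; positivity
  -- the size of the translate-constellations
  obtain ⟨L', hL'⟩ : ∃ L' : ℕ, L' = (3 * m + 1) * max L 1 := ⟨_, rfl⟩
  -- thresholds: the averaged main terms (a theorem of the line) and ATOM L at dimension `(m+1)t`
  obtain ⟨N₃, hN₃⟩ := singularMean m t L ht ε₅ hε₅0
  obtain ⟨N₁, hN₁⟩ := hA ((m + 1) * t) L' hT1 η' hη'0
  refine ⟨N₁ + N₃ + 1, fun N hN Ψ hΨ hL K hK hKN => ?_⟩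
  have hNN₁ : N₁ ≤ N := by omega
  have hNN₃ : N₃ ≤ N := by omega
  have hN1 : 1 ≤ N := by omega
  have hN0 : (0 : ℝ) ≤ N := Nat.cast_nonneg N
  have hS0 : 0 ≤ vonMangoldtSum Ψ K N :=
    Theorems.LeeYangFibresRelativeDimOne.vonMangoldtSum_nonneg Ψ K N
  have hM0 : 0 ≤ archFactor Ψ K * singularProduct Ψ := mainTerm_nonneg hΨ K
  have hεM0 : 0 ≤ ε * (archFactor Ψ K * singularProduct Ψ) := mul_nonneg hε.le hM0
  have hεN0 : 0 ≤ ε * (N : ℝ) := mul_nonneg hε.le hN0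
  rcases lt_or_ge (archFactor Ψ K * singularProduct Ψ) (κ * N) with hlow | hhigh
  · -- LOW MASS: trivial by positivity, `(1-ε) M ≤ M < κ N ≤ ε N ≤ S + ε N`
    have h1 : archFactor Ψ K * singularProduct Ψ ≤ ε * N :=
      hlow.le.trans (mul_le_mul_of_nonneg_right hκε hN0)
    linarith
  · -- HIGH MASS: the tensor-power trick, lower half
    have hsize : ∀ H ∈ shiftBox m N, affLinSize (translateFamily Ψ H) N ≤ (L' : ℝ) := by
      intro H hH
      have h2 : (L : ℝ) ≤ ((max L 1 : ℕ) : ℝ) := by exact_mod_cast le_max_left L 1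
      calc affLinSize (translateFamily Ψ H) N ≤ (3 * m + 1) * (L : ℝ) :=
            affLinSize_translateFamily_le hN1 hL hH
        _ ≤ (3 * m + 1) * ((max L 1 : ℕ) : ℝ) := mul_le_mul_of_nonneg_left h2 (by positivity)
        _ = (L' : ℝ) := by rw [hL']; push_cast; ring
    have hkM : k * (N : ℝ) ^ (m + 1) ≤ (archFactor Ψ K * singularProduct Ψ) ^ (m + 1) := by
      rw [hk, ← mul_pow]
      exact pow_le_pow_left₀ (by positivity) hhigh _
    have key := lower_high_mass_amplify (shiftBox m N)
      (fun H => IsNondegenerateSystem (translateFamily Ψ H))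
      (fun H => vonMangoldtSum (translateFamily Ψ H) (meetTranslates K H) N)
      (fun H => archFactor (translateFamily Ψ H) (meetTranslates K H) *
        singularProduct (translateFamily Ψ H))
      m hA1 he0.le he1 hS0 hM0 hk0.le hk1 hkM hε₅ hη' (completeSum m t N Ψ K hKN)
      (hN₃ N hNN₃ Ψ hΨ hL K hK hKN)
      (fun H hH hnd => by
        have h := hN₁ N hNN₁ (translateFamily Ψ H) hnd (hsize H hH) (meetTranslates K H)
          (convex_meetTranslates hK H) ((meetTranslates_subset K H).trans hKN)
        have hMH : 0 ≤ archFactor (translateFamily Ψ H) (meetTranslates K H) *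
            singularProduct (translateFamily Ψ H) := mainTerm_nonneg hnd _
        have h2 := mul_le_mul_of_nonneg_right hexpL hMH
        show A⁻¹ * (archFactor (translateFamily Ψ H) (meetTranslates K H) *
            singularProduct (translateFamily Ψ H)) - η' * N ≤
          vonMangoldtSum (translateFamily Ψ H) (meetTranslates K H) N
        linarith)
      (fun H _ => Theorems.LeeYangFibresRelativeDimOne.vonMangoldtSum_nonneg _ _ _)
      (card_shiftBox_real_le m hN1)
      (by rw [hAdef]; exact lower_ratio m he0.le he1)
    -- `(1 - ε) M ≤ (1 - e/2) M ≤ S ≤ S + ε N`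
    have h3 : (1 - ε) * (archFactor Ψ K * singularProduct Ψ) ≤
        (1 - e / 2) * (archFactor Ψ K * singularProduct Ψ) :=
      mul_le_mul_of_nonneg_right (by linarith) hM0
    linarith

end Summit.Parity.GeneralizedHardyLittlewood.Cruxes.RelativeDimOne.TranslateAmplification
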